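import Summits.PneNP.PneNP.Theses.ConvexRankGates
import Summits.PneNP.PneNP.Theorems.CliqueExtLowerBound.Negative.LoadBearing
import Summits.PneNP.PneNP.Theorems.ConvexRankGatesCliqueExtLowerBoundWidthThresholdDefs
import Summits.PneNP.PneNP.Theorems.ConvexRankGatesCliqueExtLowerBoundWidthThresholdNarrow

/-!
# Reduction of the crux `CliqueExtLowerBound` to two single-gate REPLACEABILITY statements
(line `width-threshold-certificate-sparsity`, stmt-PneNP-10682, route PneNP/ConvexRankGates)

**Theorem (`cliqueExtLowerBound_of_replaceable`, conditional).** If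
(A) every WIDE ALGEBRAIC gate (PERM/GRANK of width in `(⌊m^{1/16}⌋₊, m^c]`) and
(C) every CONV gate of width `≤ m^c`
is REPLACEABLE on the referee push-forwards — fed with local child pairs (`(r-1)`-DNFs below
`(s-1)`-CNFs over the edges, at most `m^{c+3}` distinct pairs), there is a `{∧₂,∨₂,0,1}`-circuit with
`≤ m^a` gates on the gate's input positions which dominates the gate on all but a `1/(8m^{c+1})`
fraction of the bare `⌈m^{1/4}⌉₊`-cliques and is dominated by it on all but a `1/(8m^{c+1})` fraction
of the complements of the `#E/⌊m^{1/8}⌋₊`-edge graphs (`Replaceable`, `…WidthThresholdDefs`) —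
then `CliqueExtLowerBound` holds (at `δ = 1/4`).

Everything else of the line is a landed theorem: the event-currency engine (`stub_engine`), inline
freeness (`stub_inline`), the width threshold (`stub_narrowAlgebraic`), the referee (`stub_referee`),
composed in `…WidthThresholdNarrow.lean` (`core`, `narrowLowerBound`). So the crux is now EXACTLY the
conjunction of two two-sided, distributional, SINGLE-GATE blindness statements on one explicit pair —
the single-gate contents of cruxes #4 (`LinAlgGateBlind`) and #2 (`ConvexGateBlind`) of the route in the
form this line needs them; the cheap exits (gate blind on one side; gate computed by a small monotone
circuit) are landed in `…StubAlgebraicReplaceableHelpers.lean` (`conclusion_of_cheap_exit`).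

References: S. Jukna, *Boolean Function Complexity* (2012), §9.4 [Jukna2012].
-/

set_option linter.dupNamespace false

open Literature.Computability.Complexity Filter Finset
open Summit.PneNP.PneNP.Theorems.CliqueExtLowerBound.Negative (LowerBoundAt cliqueExtLowerBound_iff)

noncomputable section

namespace Summit.PneNP.PneNP.Theorems.CliqueExtLowerBound.WidthThreshold

/-- **The crux from the two replaceability statements** (registered sub-goal
`cliqueExtLowerBound_of_replaceable`): pick `r, s` as maxima of the thresholds of `stub_inline` (at the
two monotone complexities `m^{a₁}`, `m^{a₂}`) and `stub_narrowAlgebraic`, intersect the eventualities with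
the two hypotheses and `stub_referee`, feed every gate class into `gates_sandwichable`, run `core`, and
cross the landed bridge `Negative.cliqueExtLowerBound_iff` at `δ = 1/4`. [cite: Jukna2012, Thm. 9.17] -/
theorem cliqueExtLowerBound_of_replaceable :
    (∀ c : ℕ, ∃ a : ℕ, ∀ r s : ℕ, 2 ≤ r → 2 ≤ s → ∀ᶠ m : ℕ in atTop, ∀ φ : GateFn,
      (IsPermGate (m ^ c) φ ∨ IsGRankGate (m ^ c) φ) → ¬ (IsPermGate (TT m) φ ∨ IsGRankGate (TT m) φ) →
        Replaceable r s (m ^ (c + 3)) (m ^ a) (posFam m) (negFam m) (eps m c) φ) →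
    (∀ c : ℕ, ∃ a : ℕ, ∀ r s : ℕ, 2 ≤ r → 2 ≤ s → ∀ᶠ m : ℕ in atTop, ∀ φ : GateFn,
      IsConvGate (m ^ c) φ → Replaceable r s (m ^ (c + 3)) (m ^ a) (posFam m) (negFam m) (eps m c) φ) →
    Summit.PneNP.PneNP.Theses.ConvexRankGates.CliqueExtLowerBound := by
  intro hAlg hConv
  rw [cliqueExtLowerBound_iff]
  refine ⟨1 / 4, by norm_num, by norm_num, fun c => ?_⟩
  obtain ⟨a₁, hConv⟩ := hConv c
  obtain ⟨a₂, hAlg⟩ := hAlg c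
  obtain ⟨r₁, s₁, hr₁, hs₁, hI₁⟩ := inline_statement a₁ c
  obtain ⟨r₂, s₂, hr₂, hs₂, hI₂⟩ := inline_statement a₂ c
  obtain ⟨r₃, s₃, hr₃, hs₃, hN⟩ := narrowAlgebraic_statement c
  set r := max r₁ (max r₂ r₃) with hr
  set s := max s₁ (max s₂ s₃) with hs
  have hr2 : 2 ≤ r := le_trans hr₁ (le_max_left _ _)
  have hs2 : 2 ≤ s := le_trans hs₁ (le_max_left _ _)
  have E₁ := hI₁ r s (le_max_left _ _) (le_max_left _ _)
  have E₂ := hI₂ r s ((le_max_left _ _).trans (le_max_right _ _))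
    ((le_max_left _ _).trans (le_max_right _ _))
  have E₃ := hN r s ((le_max_right _ _).trans (le_max_right _ _))
    ((le_max_right _ _).trans (le_max_right _ _))
  have E₄ := hAlg r s hr2 hs2
  have E₅ := hConv r s hr2 hs2
  have E₆ := referee_statement s
  filter_upwards [E₁, E₂, E₃, E₄, E₅, E₆, eventually_ge_atTop 3] with m h₁ h₂ h₃ h₄ h₅ h₆ hm C hC hsize
  exact core hr2 hs2 hm h₆.1 h₆.2 (fun φ hφ => extGate_monotone hφ)
    (gates_sandwichable (by omega) h₁ h₂ h₃ h₄ h₅) C hC hsize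

/-! ## Reshape r3 (2026-08-16): the reduction in the engine's own currency

The CONV hypothesis of `cliqueExtLowerBound_of_replaceable` is REFUTED as a universal statement
(`Negative.stub_convReplaceable_false`, the anchored theta gate: `Replaceable` is strictly stronger than what
`core` consumes). The composition needs only SANDWICHABILITY of every gate; so the crux follows from the two
weaker statements below (CONV gates sandwichable — this covers `∧₂, ∨₂ ∈ CONV₁`; wide PERM/GRANK gates
sandwichable), the landed narrow-algebraic theorem and the referee. -/

/-- Every gate of `B_{m^c}` is sandwichable with error `2ε` from: CONV gates sandwichable (covers `∧₂, ∨₂`),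
narrow algebraic gates sandwichable (landed `stub_narrowAlgebraic`), wide algebraic gates sandwichable.
[folklore] -/
theorem gates_sandwichable_direct {m c r s : ℕ} (hm : 1 ≤ m)
    (hConv : ∀ φ : GateFn, IsConvGate (m ^ c) φ →
      Sandwichable r s (m ^ (c + 3)) (posFam m) (negFam m) (eps m c) φ)
    (hN : ∀ φ : GateFn, (IsPermGate (TT m) φ ∨ IsGRankGate (TT m) φ) →
      Sandwichable r s (m ^ (c + 3)) (posFam m) (negFam m) (eps m c) φ)
    (hAlg : ∀ φ : GateFn, (IsPermGate (m ^ c) φ ∨ IsGRankGate (m ^ c) φ) →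
      ¬ (IsPermGate (TT m) φ ∨ IsGRankGate (TT m) φ) →
      Sandwichable r s (m ^ (c + 3)) (posFam m) (negFam m) (eps m c) φ)
    (φ : GateFn) (hφ : φ ∈ extGate (m ^ c)) :
    Sandwichable r s (m ^ (c + 3)) (posFam m) (negFam m) (2 * eps m c) φ := by
  have h1c : 1 ≤ m ^ c := Nat.one_le_pow _ _ hm
  have hε0 : 0 ≤ eps m c := by unfold eps; positivity
  have hle : eps m c ≤ 2 * eps m c := by linarith
  rw [mem_extGate_iff] at hφ
  rcases hφ with rfl | rfl | h | h | h
  · exact (hConv _ ((and_isConvGate 2).mono h1c)).of_le hle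
  · exact (hConv _ ((or_isConvGate 2).mono h1c)).of_le hle
  · exact (hConv _ h).of_le hle
  · by_cases hn : IsPermGate (TT m) φ ∨ IsGRankGate (TT m) φ
    · exact (hN φ hn).of_le hle
    · exact (hAlg φ (Or.inl h) hn).of_le hle
  · by_cases hn : IsPermGate (TT m) φ ∨ IsGRankGate (TT m) φ
    · exact (hN φ hn).of_le hle
    · exact (hAlg φ (Or.inr h) hn).of_le hle

/-- **The crux from the two SANDWICHABILITY statements** (registered sub-goal
`cliqueExtLowerBound_of_sandwichable`; reshape r3 of the line): if every wide PERM/GRANK gate and every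
CONV gate of width `≤ m^c`, fed with local child pairs, is `(r,s)`-sandwichable on the referee pair with
error `1/(8m^{c+1})` for all `r ≥ r₀(c)`, `s ≥ s₀(c)`, eventually in `m`, then `CliqueExtLowerBound` holds
(at `δ = 1/4`). Everything else is landed (`core`, `narrowAlgebraic_statement`, `referee_statement`).
[cite: Jukna2012, Thm. 9.17] -/
theorem cliqueExtLowerBound_of_sandwichable :
    (∀ c : ℕ, ∃ r₀ s₀ : ℕ, 2 ≤ r₀ ∧ 2 ≤ s₀ ∧ ∀ r s : ℕ, r₀ ≤ r → s₀ ≤ s → ∀ᶠ m : ℕ in atTop,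
      ∀ φ : GateFn, (IsPermGate (m ^ c) φ ∨ IsGRankGate (m ^ c) φ) →
        ¬ (IsPermGate (TT m) φ ∨ IsGRankGate (TT m) φ) →
        Sandwichable r s (m ^ (c + 3)) (posFam m) (negFam m) (eps m c) φ) →
    (∀ c : ℕ, ∃ r₀ s₀ : ℕ, 2 ≤ r₀ ∧ 2 ≤ s₀ ∧ ∀ r s : ℕ, r₀ ≤ r → s₀ ≤ s → ∀ᶠ m : ℕ in atTop,
      ∀ φ : GateFn, IsConvGate (m ^ c) φ →
        Sandwichable r s (m ^ (c + 3)) (posFam m) (negFam m) (eps m c) φ) →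
    Summit.PneNP.PneNP.Theses.ConvexRankGates.CliqueExtLowerBound := by
  intro hAlg hConv
  rw [cliqueExtLowerBound_iff]
  refine ⟨1 / 4, by norm_num, by norm_num, fun c => ?_⟩
  obtain ⟨r₁, s₁, hr₁, hs₁, hC⟩ := hConv c
  obtain ⟨r₂, s₂, hr₂, hs₂, hA⟩ := hAlg c
  obtain ⟨r₃, s₃, hr₃, hs₃, hN⟩ := narrowAlgebraic_statement c
  set r := max r₁ (max r₂ r₃) with hr
  set s := max s₁ (max s₂ s₃) with hs
  have hr2 : 2 ≤ r := le_trans hr₁ (le_max_left _ _)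
  have hs2 : 2 ≤ s := le_trans hs₁ (le_max_left _ _)
  have E₁ := hC r s (le_max_left _ _) (le_max_left _ _)
  have E₂ := hA r s ((le_max_left _ _).trans (le_max_right _ _))
    ((le_max_left _ _).trans (le_max_right _ _))
  have E₃ := hN r s ((le_max_right _ _).trans (le_max_right _ _))
    ((le_max_right _ _).trans (le_max_right _ _))
  have E₆ := referee_statement s
  filter_upwards [E₁, E₂, E₃, E₆, eventually_ge_atTop 3] with m h₁ h₂ h₃ h₆ hm C hC hsize
  exact core hr2 hs2 hm h₆.1 h₆.2 (fun φ hφ => extGate_monotone hφ)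
    (gates_sandwichable_direct (by omega) h₁ h₃ h₂) C hC hsize

end Summit.PneNP.PneNP.Theorems.CliqueExtLowerBound.WidthThreshold

end
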